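import Literature.Combinatorics.StablePolynomials.GraceWalshSzego
import HarnessLib

/-!
# Polarization in blocks of variables: Borcea–Brändén I, §2.2, Proposition 2.4 for every `κ ∈ ℕⁿ`
# (the multivariate Grace–Walsh–Szegő reduction)

J. Borcea, P. Brändén, *The Lee–Yang and Pólya–Schur programs. I. Linear operators preserving stability*,
Invent. Math. 177 (2009) 541–569 (arXiv:0809.0401), §2.2:

> Let `κ = (κ_1,…,κ_n) ∈ ℕⁿ` … and `z_{ij}`, `i ∈ [n]`, `1 ≤ j ≤ κ_i`, be new variables. For
> `f ∈ 𝕂_κ[z_1,…,z_n]` let `Π↑_κ(f)` be the unique polynomial in the `z_{ij}` that is multi-affine,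
> symmetric in each group of variables `z_{i1},…,z_{iκ_i}`, `i ∈ [n]`, and such that
> `Π↓_κ(Π↑_κ(f)) = f`, where `Π↓_κ` sets `z_{ij} = z_i` … explicitly
> `Π↑_κ(z^α) = Π_i binom(κ_i,α_i)⁻¹ e_{α_i}(z_{i1},…,z_{iκ_i})`.
> **Proposition 2.4.** … `f` is stable if and only if `Π↑_κ(f)` is stable.
> (a) `Π↑_κ, Π↓_κ` preserve stability; (b) `Π↓_κ ∘ Π↑_κ = id`; (c) hence the proofs of Theorems 1.1–1.3
> reduce to the case of multi-affine polynomials.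

This file formalises the construction in a cast-free form: the blocks of variables are the **fibers of a map
`b : σ → τ` of finite index types** (so the original variables are `τ`, the new ones `σ`, `Π↓ = rename b`,
and `κ_i = |b⁻¹(i)|`), and proves Proposition 2.4 for all `κ`
(`isUpperHalfPlaneStable_fiberPolarization_iff`). The key step is the **block form of the Grace–Walsh–Szegő
theorem** (`exists_eval_eq_eval_comp`): a multi-affine polynomial symmetric within each fiber takes, at any
point of `ℋ^σ`, the same value as at some point that is constant on each fiber (with values in `ℋ`); it is
obtained from the tree's one-block version `exists_eval_eq_eval_const_of_im_pos` (`GraceWalshSzego.lean`)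
applied fiber by fiber to the slices `fiberSlice` (the other variables frozen at their current values, as in
the printed "repeated application" of the one-variable statement).

## Contents

* §1 `fiber`, `IsFiberSymmetric`, `fiberSliceFun`/`fiberSlice`/`fiberUpdate`, `eval_fiberSlice`,
  `isMultiAffine_fiberSlice`, `rename_perm_fiberSlice`, **`exists_eval_eq_eval_comp`** (block GWS).
* §2 `fiberEsymm` (`e_k` of a block), `rename_perm_fiberEsymm`, `rename_fiberEsymm`, `degreeOf_fiberEsymm_le`,
  `fiberPolarization b = Π↑` (on the monomial basis), `fiberPolarization_monomial`,
  `rename_fiberPolarization` (`Π↓Π↑ = id` on `ℂ_κ`), `isMultiAffine_fiberPolarization`,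
  `isFiberSymmetric_fiberPolarization`, `eval_comp_fiberPolarization`,
  **`isUpperHalfPlaneStable_fiberPolarization_iff`** (Prop. 2.4), `isUpperHalfPlaneStable_rename_of_comp`
  (`Π↓` preserves stability).

## References

* [BorceaBranden2009] J. Borcea, P. Brändén, Invent. Math. 177 (2009) 541–569, §2.2 (Π↑_κ, Π↓_κ, Prop. 2.4,
  Thm. 2.3 Grace–Walsh–Szegő).
-/

noncomputable section

open MvPolynomial Finset

namespace Literature.Combinatorics.StablePolynomials

variable {σ τ : Type*} (b : σ → τ)

/-! ## §1 Fibers, fiber symmetry, slices, and the block Grace–Walsh–Szegő theorem -/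

section Fibers

variable [DecidableEq τ]

omit [DecidableEq τ] in
/-- **Symmetry in each group of variables**: invariance under every permutation of the new variables that
preserves the blocks. [cite: BorceaBranden2009, §2.2 ("symmetric in each group of variables
`z_{i1},…,z_{iκ_i}`")] -/
def IsFiberSymmetric {R : Type*} [CommSemiring R] (F : MvPolynomial σ R) : Prop :=
  ∀ e : Equiv.Perm σ, (∀ v, b (e v) = b v) → rename (⇑e) F = F

/-- The substitution freezing all variables outside the block `i` at the values `W` (block-`i` variables are
kept, indexed by the subtype `{v // b v = i}`). [cite: BorceaBranden2009, §2.2 proof of Prop. 2.4 (repeated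
application of the Grace–Walsh–Szegő theorem, one group of variables at a time)] -/
def fiberSliceFun (i : τ) (W : σ → ℂ) : σ → MvPolynomial {v // b v = i} ℂ :=
  fun v => if h : b v = i then X ⟨v, h⟩ else C (W v)

/-- **The slice of `F` along the block `i` at `W`**: a polynomial in the block-`i` variables alone.
[cite: BorceaBranden2009, §2.2 proof of Prop. 2.4] -/
def fiberSlice (i : τ) (W : σ → ℂ) : MvPolynomial σ ℂ →ₐ[ℂ] MvPolynomial {v // b v = i} ℂ :=
  bind₁ (fiberSliceFun b i W)

/-- Replacing the block-`i` coordinates of `W` by `w`. [cite: BorceaBranden2009, §2.2 proof of Prop. 2.4] -/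
def fiberUpdate (i : τ) (W : σ → ℂ) (w : {v // b v = i} → ℂ) : σ → ℂ :=
  fun v => if h : b v = i then w ⟨v, h⟩ else W v

/-- Updating a block with its own values changes nothing. [cite: BorceaBranden2009, §2.2] -/
theorem fiberUpdate_self (i : τ) (W : σ → ℂ) : fiberUpdate b i W (fun u => W u.1) = W := by
  funext v
  unfold fiberUpdate
  split_ifs <;> rfl

/-- Evaluating the frozen substitution. [cite: BorceaBranden2009, §2.2 proof of Prop. 2.4] -/
theorem aeval_fiberSliceFun (i : τ) (W : σ → ℂ) (w : {v // b v = i} → ℂ) (v : σ) :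
    aeval w (fiberSliceFun b i W v) = fiberUpdate b i W w v := by
  unfold fiberSliceFun fiberUpdate
  by_cases h : b v = i
  · rw [dif_pos h, dif_pos h, aeval_X]
  · rw [dif_neg h, dif_neg h, aeval_C]
    rfl

/-- **Evaluating a slice** is evaluating `F` at the updated point. [cite: BorceaBranden2009, §2.2 proof of
Prop. 2.4] -/
theorem eval_fiberSlice (i : τ) (W : σ → ℂ) (w : {v // b v = i} → ℂ) (F : MvPolynomial σ ℂ) :
    eval w (fiberSlice b i W F) = eval (fiberUpdate b i W w) F := by
  show aeval w (bind₁ (fiberSliceFun b i W) F) = aeval (fiberUpdate b i W w) F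
  rw [aeval_bind₁]
  simp only [aeval_fiberSliceFun]

/-- The frozen substitution has degree `≤ 1` in each block variable, and `0` unless the variable matches.
[cite: BorceaBranden2009, §2.2] -/
theorem degreeOf_fiberSliceFun_le [DecidableEq σ] (i : τ) (W : σ → ℂ) (u : {v // b v = i}) (v : σ) :
    degreeOf u (fiberSliceFun b i W v) ≤ if v = u.1 then 1 else 0 := by
  unfold fiberSliceFun
  by_cases h : b v = i
  · rw [dif_pos h]
    by_cases huv : v = u.1
    · rw [if_pos huv]
      have : (⟨v, h⟩ : {v // b v = i}) = u := Subtype.ext huv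
      rw [this, degreeOf_X_self]
    · rw [if_neg huv, degreeOf_X_of_ne (fun h' => huv (by rw [h']))]
  · rw [dif_neg h, degreeOf_C]
    exact Nat.zero_le _

/-- **Slices of multi-affine polynomials are multi-affine.** [cite: BorceaBranden2009, §2.2 proof of
Prop. 2.4] -/
theorem isMultiAffine_fiberSlice (i : τ) (W : σ → ℂ) {F : MvPolynomial σ ℂ} (hF : IsMultiAffine F) :
    IsMultiAffine (fiberSlice b i W F) := by
  classical
  intro u
  rw [fiberSlice, F.as_sum, map_sum]
  refine (degreeOf_sum_le _ _ _).trans (Finset.sup_le fun m hm => ?_)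
  rw [bind₁_monomial]
  refine (degreeOf_C_mul_le _ _ _).trans ((degreeOf_prod_le _ _ _).trans ?_)
  calc ∑ v ∈ m.support, degreeOf u (fiberSliceFun b i W v ^ m v)
      ≤ ∑ v ∈ m.support, (if v = u.1 then m v else 0) := by
        refine sum_le_sum fun v _ => (degreeOf_pow_le _ _ _).trans ?_
        have h := degreeOf_fiberSliceFun_le b i W u v
        split_ifs at h ⊢ with hv
        · simpa using Nat.mul_le_mul_left (m v) h
        · rw [Nat.le_zero.1 h, mul_zero]
    _ = if u.1 ∈ m.support then m u.1 else 0 := Finset.sum_ite_eq' _ _ _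
    _ ≤ m u.1 := by split_ifs <;> simp
    _ ≤ 1 := (monomial_le_degreeOf u.1 hm).trans (hF u.1)

/-- Extending a permutation of the block `i` by the identity preserves the blocks.
[cite: BorceaBranden2009, §2.2] -/
theorem apply_ofSubtype_fiber (i : τ) (e : Equiv.Perm {v // b v = i}) (v : σ) :
    b (Equiv.Perm.ofSubtype e v) = b v := by
  by_cases h : b v = i
  · rw [Equiv.Perm.ofSubtype_apply_of_mem e h]
    exact (e ⟨v, h⟩).2.trans h.symm
  · rw [Equiv.Perm.ofSubtype_apply_of_not_mem e h]

/-- **Slices of fiber-symmetric polynomials are symmetric.** [cite: BorceaBranden2009, §2.2 proof of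
Prop. 2.4] -/
theorem rename_perm_fiberSlice (i : τ) (W : σ → ℂ) {F : MvPolynomial σ ℂ} (hFs : IsFiberSymmetric b F)
    (e : Equiv.Perm {v // b v = i}) : rename (⇑e) (fiberSlice b i W F) = fiberSlice b i W F := by
  have key : (fun v => rename (⇑e) (fiberSliceFun b i W v)) =
      fiberSliceFun b i W ∘ ⇑(Equiv.Perm.ofSubtype e) := by
    funext v
    simp only [Function.comp_apply, fiberSliceFun]
    by_cases h : b v = i
    · rw [dif_pos h, rename_X, Equiv.Perm.ofSubtype_apply_of_mem e h, dif_pos (e ⟨v, h⟩).2]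
    · rw [dif_neg h, rename_C, Equiv.Perm.ofSubtype_apply_of_not_mem e h, dif_neg h]
  calc rename (⇑e) (fiberSlice b i W F)
      = bind₁ (fiberSliceFun b i W ∘ ⇑(Equiv.Perm.ofSubtype e)) F := by rw [fiberSlice, rename_bind₁, key]
    _ = fiberSlice b i W (rename (⇑(Equiv.Perm.ofSubtype e)) F) := by rw [fiberSlice, bind₁_rename]
    _ = fiberSlice b i W F := by rw [hFs _ (apply_ofSubtype_fiber b i e)]

/-- **The Grace–Walsh–Szegő theorem in blocks.** A multi-affine polynomial `F` in the variables `σ`, symmetric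
within each block `b⁻¹(i)`, takes at every `W ∈ ℋ^σ` the same value as at a point `ζ ∘ b` that is constant on
each block, with `ζ ∈ ℋ^τ`. (One block at a time: freeze the other variables and apply the one-block
theorem to the slice.) [cite: BorceaBranden2009, §2.2 Thm. 2.3 (Grace–Walsh–Szegő) and the proof of
Prop. 2.4] -/
theorem exists_eval_eq_eval_comp [Fintype σ] [DecidableEq σ] [Fintype τ] {F : MvPolynomial σ ℂ}
    (hF : IsMultiAffine F) (hFs : IsFiberSymmetric b F)
    (W : σ → ℂ) (hW : ∀ v, 0 < (W v).im) :
    ∃ ζ : τ → ℂ, (∀ i, 0 < (ζ i).im) ∧ eval W F = eval (ζ ∘ b) F := by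
  classical
  suffices h : ∀ s : Finset τ, ∃ ζ : τ → ℂ, (∀ i, 0 < (ζ i).im) ∧
      eval W F = eval (fun v => if b v ∈ s then ζ (b v) else W v) F by
    obtain ⟨ζ, hζ, h⟩ := h univ
    exact ⟨ζ, hζ, by simpa [Function.comp_def] using h⟩
  intro s
  induction s using Finset.induction_on with
  | empty => exact ⟨fun _ => Complex.I, fun _ => by simp, by simp⟩
  | insert i s hi ih =>
    obtain ⟨ζ, hζ, hWV⟩ := ih
    set V : σ → ℂ := fun v => if b v ∈ s then ζ (b v) else W v with hV
    have hVim : ∀ v, 0 < (V v).im := fun v => by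
      simp only [hV]
      split_ifs
      · exact hζ _
      · exact hW v
    obtain ⟨ζi, hζi, hG⟩ := exists_eval_eq_eval_const_of_im_pos (isMultiAffine_fiberSlice b i V hF)
      (fun e => rename_perm_fiberSlice b i V hFs e) (fun u : {v // b v = i} => V u.1) fun u => hVim u.1
    rw [eval_fiberSlice, eval_fiberSlice, fiberUpdate_self] at hG
    have hfun : fiberUpdate b i V (fun _ => ζi) =
        fun v => if b v ∈ insert i s then Function.update ζ i ζi (b v) else W v := by
      funext v
      simp only [fiberUpdate, hV, Finset.mem_insert]
      by_cases h1 : b v = i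
      · simp [h1]
      · simp [h1]
    refine ⟨Function.update ζ i ζi, fun j => ?_, ?_⟩
    · by_cases hj : j = i
      · subst hj
        simpa using hζi
      · simpa [Function.update_of_ne hj] using hζ j
    · rw [hWV, hG, hfun]

end Fibers

/-! ## §2 The polarization `Π↑` along `b` and Proposition 2.4 -/

section Polarization

variable [Fintype σ] [DecidableEq τ]

/-- The **block of new variables** above the old variable `i`: the fiber `b⁻¹(i)` (printed: `z_{i1},…,z_{iκ_i}`,
`κ_i = |b⁻¹(i)|`). [cite: BorceaBranden2009, §2.2 ("new variables `z_{ij}`, `1 ≤ j ≤ κ_i`")] -/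
def fiber (i : τ) : Finset σ :=
  univ.filter fun v => b v = i

/-- Membership in a fiber. [cite: BorceaBranden2009, §2.2] -/
theorem mem_fiber {i : τ} {v : σ} : v ∈ fiber b i ↔ b v = i := by
  simp [fiber]

/-- **`e_k` of the block `i`**: the `k`-th elementary symmetric polynomial of the variables in `b⁻¹(i)`.
[cite: BorceaBranden2009, §2.2 ("`e_{α_i}(z_{i1},…,z_{iκ_i})`")] -/
def fiberEsymm {R : Type*} [CommSemiring R] (i : τ) (k : ℕ) : MvPolynomial σ R :=
  ∑ S ∈ powersetCard k (fiber b i), ∏ v ∈ S, X v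

/-- A block-preserving permutation maps each block onto itself. [cite: BorceaBranden2009, §2.2] -/
theorem map_perm_fiber (e : Equiv.Perm σ) (he : ∀ v, b (e v) = b v) (i : τ) :
    (fiber b i).map e.toEmbedding = fiber b i := by
  ext v
  rw [mem_map_equiv, mem_fiber, mem_fiber, ← he (e.symm v), Equiv.apply_symm_apply]

/-- `e_k` of a block is symmetric under block-preserving permutations. [cite: BorceaBranden2009, §2.2] -/
theorem rename_perm_fiberEsymm {R : Type*} [CommSemiring R] (e : Equiv.Perm σ) (he : ∀ v, b (e v) = b v)
    (i : τ) (k : ℕ) : rename (⇑e) (fiberEsymm b i k : MvPolynomial σ R) = fiberEsymm b i k := by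
  rw [fiberEsymm, map_sum]
  conv_rhs => rw [← map_perm_fiber b e he i, powersetCard_map, sum_map]
  refine sum_congr rfl fun S _ => ?_
  rw [map_prod]
  simp only [rename_X]
  rw [RelEmbedding.coe_toEmbedding, mapEmbedding_apply, prod_map]
  rfl

/-- **`Π↓ e_k(block i) = binom(κ_i,k) z_i^k`.** [cite: BorceaBranden2009, §2.2 ("`Π↑_κ(z^α) =
binom(κ,α)⁻¹ …`", "(b) `Π↓_κ ∘ Π↑_κ = id`")] -/
theorem rename_fiberEsymm {R : Type*} [CommSemiring R] (i : τ) (k : ℕ) :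
    rename b (fiberEsymm b i k : MvPolynomial σ R) = ((fiber b i).card.choose k) • X i ^ k := by
  rw [fiberEsymm, map_sum]
  have h : ∀ S ∈ powersetCard k (fiber b i), rename b (∏ v ∈ S, X v : MvPolynomial σ R) = X i ^ k := by
    intro S hS
    rw [mem_powersetCard] at hS
    rw [map_prod, ← hS.2, ← prod_const]
    refine prod_congr rfl fun v hv => ?_
    rw [rename_X, (mem_fiber b).1 (hS.1 hv)]
  rw [sum_congr rfl h, sum_const, card_powersetCard]

/-- `e_k` of the block `i` has degree `≤ 1` in the variables of that block and `0` in the others.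
[cite: BorceaBranden2009, §2.2 ("multi-affine")] -/
theorem degreeOf_fiberEsymm_le (i : τ) (k : ℕ) (v : σ) :
    degreeOf v (fiberEsymm b i k : MvPolynomial σ ℂ) ≤ if b v = i then 1 else 0 := by
  classical
  rw [fiberEsymm]
  refine (degreeOf_sum_le _ _ _).trans (Finset.sup_le fun S hS => ?_)
  refine (degreeOf_prod_le _ _ _).trans ?_
  rw [mem_powersetCard] at hS
  by_cases hv : b v = i
  · rw [if_pos hv]
    calc ∑ u ∈ S, degreeOf v (X u : MvPolynomial σ ℂ) ≤ ∑ u ∈ S, (if u = v then 1 else 0) :=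
          sum_le_sum fun u _ => by
            by_cases huv : u = v
            · rw [if_pos huv, huv, degreeOf_X_self]
            · rw [if_neg huv, degreeOf_X_of_ne (Ne.symm huv)]
      _ = if v ∈ S then 1 else 0 := sum_ite_eq' _ _ _
      _ ≤ 1 := by split_ifs <;> simp
  · rw [if_neg hv]
    refine (sum_le_sum fun u hu => ?_).trans (by rw [sum_const_zero])
    rw [degreeOf_X_of_ne fun h => hv (by rw [h]; exact (mem_fiber b).1 (hS.1 hu))]

variable [Fintype τ]

/-- **The polarization `Π↑` along `b`** (Borcea–Brändén's `Π↑_κ`, `κ_i = |b⁻¹(i)|`), defined on the monomial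
basis by `Π↑(z^α) = Π_i binom(κ_i,α_i)⁻¹ e_{α_i}(block i)`. [cite: BorceaBranden2009, §2.2 ("explicitly,
`Π↑_κ(z^α) = binom(κ,α)⁻¹ Π_i e_{α_i}(z_{i1},…,z_{iκ_i})`")] -/
def fiberPolarization : MvPolynomial τ ℂ →ₗ[ℂ] MvPolynomial σ ℂ :=
  (basisMonomials τ ℂ).constr ℂ fun α =>
    ∏ i, ((((fiber b i).card.choose (α i) : ℕ) : ℂ)⁻¹ • (fiberEsymm b i (α i) : MvPolynomial σ ℂ))

/-- `Π↑` on monomials. [cite: BorceaBranden2009, §2.2 (formula for `Π↑_κ(z^α)`)] -/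
theorem fiberPolarization_monomial (α : τ →₀ ℕ) (c : ℂ) :
    fiberPolarization b (monomial α c) =
      c • ∏ i, ((((fiber b i).card.choose (α i) : ℕ) : ℂ)⁻¹ • (fiberEsymm b i (α i) : MvPolynomial σ ℂ)) := by
  have h : (monomial α c : MvPolynomial τ ℂ) = c • basisMonomials τ ℂ α := by
    rw [coe_basisMonomials, smul_monomial, smul_eq_mul, mul_one]
  rw [h, map_smul, fiberPolarization, Module.Basis.constr_basis]

/-- **`Π↓Π↑(z^α) = z^α`** for `α ≤ κ`. [cite: BorceaBranden2009, §2.2 ("(b) `Π↓_κ ∘ Π↑_κ = id`")] -/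
theorem rename_fiberPolarization_monomial {α : τ →₀ ℕ} (hα : ∀ i, α i ≤ (fiber b i).card) (c : ℂ) :
    rename b (fiberPolarization b (monomial α c)) = monomial α c := by
  rw [fiberPolarization_monomial, map_smul, map_prod]
  have h : ∀ i, rename b ((((fiber b i).card.choose (α i) : ℕ) : ℂ)⁻¹ •
      (fiberEsymm b i (α i) : MvPolynomial σ ℂ)) = X i ^ α i := by
    intro i
    rw [map_smul, rename_fiberEsymm, ← Nat.cast_smul_eq_nsmul ℂ, smul_smul,
      inv_mul_cancel₀ (Nat.cast_ne_zero.2 (Nat.choose_pos (hα i)).ne'), one_smul]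
  simp only [h]
  rw [monomial_eq, Finsupp.prod_fintype _ _ fun i => pow_zero _, smul_eq_C_mul]

/-- **`Π↓ ∘ Π↑ = id` on `ℂ_κ[z_τ]`** (polynomials of degree `≤ κ_i = |b⁻¹(i)|` in `z_i`).
[cite: BorceaBranden2009, §2.2 ("(b) `Π↓_κ ∘ Π↑_κ = id_{𝕂_κ[z_1,…,z_n]}`")] -/
theorem rename_fiberPolarization {p : MvPolynomial τ ℂ} (hp : ∀ i, degreeOf i p ≤ (fiber b i).card) :
    rename b (fiberPolarization b p) = p := by
  rw [p.as_sum, map_sum, map_sum]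
  exact sum_congr rfl fun α hα =>
    rename_fiberPolarization_monomial b (fun i => (monomial_le_degreeOf i hα).trans (hp i)) _

/-- **`Π↑ p` is multi-affine.** [cite: BorceaBranden2009, §2.2 ("`Π↑_κ(f)` … multi-affine")] -/
theorem isMultiAffine_fiberPolarization (p : MvPolynomial τ ℂ) : IsMultiAffine (fiberPolarization b p) := by
  rw [p.as_sum, map_sum]
  refine IsMultiAffine.sum _ fun α _ => ?_
  rw [fiberPolarization_monomial]
  have h : IsMultiAffine (∏ i, ((((fiber b i).card.choose (α i) : ℕ) : ℂ)⁻¹ •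
      (fiberEsymm b i (α i) : MvPolynomial σ ℂ))) := by
    intro v
    refine (degreeOf_prod_le _ _ _).trans ?_
    calc ∑ i, degreeOf v ((((fiber b i).card.choose (α i) : ℕ) : ℂ)⁻¹ •
          (fiberEsymm b i (α i) : MvPolynomial σ ℂ))
        ≤ ∑ i, (if b v = i then 1 else 0) := sum_le_sum fun i _ => by
          rw [smul_eq_C_mul]
          exact (degreeOf_C_mul_le _ _ _).trans (degreeOf_fiberEsymm_le b i (α i) v)
      _ = 1 := by rw [sum_ite_eq]; simp
  exact h.smul _

/-- **`Π↑ p` is symmetric in each group of variables.** [cite: BorceaBranden2009, §2.2 ("symmetric in each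
group of variables")] -/
theorem isFiberSymmetric_fiberPolarization (p : MvPolynomial τ ℂ) :
    IsFiberSymmetric b (fiberPolarization b p) := by
  intro e he
  have h : (rename (⇑e) : MvPolynomial σ ℂ →ₐ[ℂ] MvPolynomial σ ℂ).toLinearMap ∘ₗ fiberPolarization b =
      fiberPolarization b := by
    refine (basisMonomials τ ℂ).ext fun α => ?_
    show rename (⇑e) (fiberPolarization b (basisMonomials τ ℂ α)) = fiberPolarization b (basisMonomials τ ℂ α)
    rw [coe_basisMonomials]
    show rename (⇑e) (fiberPolarization b (monomial α 1)) = fiberPolarization b (monomial α 1)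
    rw [fiberPolarization_monomial, map_smul, map_prod]
    congr 1
    exact prod_congr rfl fun i _ => by rw [map_smul, rename_perm_fiberEsymm b e he]
  exact LinearMap.congr_fun h p

/-- `Π↑ p` at a block-constant point `ζ ∘ b` is `p(ζ)`. [cite: BorceaBranden2009, §2.2 ("(b) `Π↓_κ ∘ Π↑_κ =
id`")] -/
theorem eval_comp_fiberPolarization {p : MvPolynomial τ ℂ} (hp : ∀ i, degreeOf i p ≤ (fiber b i).card)
    (ζ : τ → ℂ) : eval (ζ ∘ b) (fiberPolarization b p) = eval ζ p := by
  rw [← eval_rename, rename_fiberPolarization b hp]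

/-- **Borcea–Brändén I, Proposition 2.4 (every `κ`).** For `p ∈ ℂ_κ[z_τ]` (`deg_{z_i} p ≤ κ_i = |b⁻¹(i)|`),
`Π↑ p` is stable iff `p` is stable: "if" by the block Grace–Walsh–Szegő theorem, "only if" by restricting to
block-constant points (`Π↓` preserves stability). [cite: BorceaBranden2009, §2.2 Prop. 2.4] -/
theorem isUpperHalfPlaneStable_fiberPolarization_iff [DecidableEq σ] {p : MvPolynomial τ ℂ}
    (hp : ∀ i, degreeOf i p ≤ (fiber b i).card) :
    IsUpperHalfPlaneStable (fiberPolarization b p) ↔ IsUpperHalfPlaneStable p := by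
  constructor
  · intro h z hz
    rw [← eval_comp_fiberPolarization b hp z]
    exact h _ fun v => hz (b v)
  · intro h W hW
    obtain ⟨ζ, hζ, hev⟩ := exists_eval_eq_eval_comp b (isMultiAffine_fiberPolarization b p)
      (isFiberSymmetric_fiberPolarization b p) W hW
    rw [hev, eval_comp_fiberPolarization b hp]
    exact h ζ hζ

omit [Fintype σ] [DecidableEq τ] [Fintype τ] in
/-- **`Π↓` preserves stability**: `(rename b F)(z) = F(z ∘ b)`. [cite: BorceaBranden2009, §2.2 ("(a) The linear
operators `Π↑_κ` and `Π↓_κ` preserve stability")] -/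
theorem isUpperHalfPlaneStable_rename_fiberMap {F : MvPolynomial σ ℂ} (hF : IsUpperHalfPlaneStable F) :
    IsUpperHalfPlaneStable (rename b F) := fun z hz => by
  rw [eval_rename]
  exact hF _ fun v => hz (b v)

end Polarization

end Literature.Combinatorics.StablePolynomials

end
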